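import Summits.NavierStokesRegularity.NavierStokesRegularity.Theorems.TypeIliouvilleNoTypeII.Negative.NSIAncientCascadeClasses
import Summits.NavierStokesRegularity.NavierStokesRegularity.Theorems.TypeIliouvilleNoTypeII.Negative.NSISuperCascadeReach
import HarnessLib

/-!
# The ancient Euler-self-similar NSI cascade, IV: `PowerGaugeEulerLiouville` is false without
# the momentum identity

Negative-lane file for `stmt-NavierStokesRegularity-0056` (kill-kit, model class M2′), bearing on
the crux `EulerZoomLiouville.PowerGaugeEulerLiouville` (item 19832; E) of §B route №10 and its open
core. **Theorem (`powerGaugeEulerLiouville_false_without_momentum`).** There is `ρ₀ > 0` such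
that for EVERY `ρ ∈ (0, ρ₀]` there are `u, p, H, c` on the ancient slab `Q = (-∞,0) × ℝ³` with:
conjuncts 1–4 of `IsDistributionalNSSolutionOn Q 0 0 u p` (local integrability of `u`, `|u|²`,
`p`; weak `div u = 0`) and, IN PLACE OF conjunct 5 (the momentum identity), the pressure LAW
`p = p̃[u]` (so the pressure Poisson identity holds exactly); the fields `energyClass`, `pressure`,
`localEnergy` of `IsSuitableWeakSolutionOn Q 0 0 u p` VERBATIM (Euler, `ν = 0`, `f = 0`);
`HasWeakSpatialGradientOn Q u H`; the gauge hypothesis `a^{2ρ}A + a^{ρ}E + a^{2ρ}D ≤ c` at `0`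
for ALL `a > 0`; and `u` is NOT a.e. zero on `(-∞,0) × ℝ³`. Witness: the ancient zoom-out `𝔘`
of the super-similar NSI cascade (parts I–III), `p = p̃[𝔘]`, `H = D𝔘`. Consequence: a proof
of E on `(0, ρ₀]` must use the momentum identity BEYOND its divergence (velocity-testing); the
local energy inequality, pressure law, gauges and classes alone cannot close it. `𝔘` has
finite non-increasing slice energy, `→ 0` at `0⁻`, `→ ∞` at `-∞` (the lead's `energeticPast`
regime). WHAT THIS IS NOT: not a refutation of E (NSI cascades fail the momentum identity).

References: Seregin, arXiv:2402.13229 (2024), (1.7), Thm 3.1; Ożański, arXiv:1709.00602 (2017),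
§2, §5 [`Ozanski2017NSISingular`]; Scheffer 1985, Lemma 2.3 [`Scheffer1985`]; CKN 1982, §2.
-/

noncomputable section

open MeasureTheory Set Function Filter Topology Metric Module
open scoped ENNReal NNReal InnerProductSpace RealInnerProductSpace Laplacian

set_option linter.dupNamespace false

namespace Summit.NavierStokesRegularity.NavierStokesRegularity.Theorems.TypeIliouvilleNoTypeIINegative

open Literature.Analysis.FluidPDE Literature.Barriers.NavierStokesRegularity
open Literature.Barriers.NavierStokesRegularity.Scheffer TopologicalSpace

/-! ### Transport of the Euler local-energy functional and of the divergence constraint -/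

section Transport

/-- Outside `Q`, the slices of a space–time test field on `Q` have zero gradient. [folklore] -/
theorem gradient_slice_eq_zero_of_notMem {Q : Opens (ℝ × EuclideanSpace ℝ (Fin 3))}
    {ψ : ℝ → EuclideanSpace ℝ (Fin 3) → ℝ} (hψ : IsSpaceTimeTestOn Q ψ) {t : ℝ}
    {x : EuclideanSpace ℝ (Fin 3)} (h : (t, x) ∉ (Q : Set (ℝ × EuclideanSpace ℝ (Fin 3)))) :
    gradient (ψ t) x = 0 := by
  rw [gradient, hψ.fderiv_slice_eq_zero h, map_zero]

/-- For a test field `θ` on `Q`, `∫∫_Q v·∇θ` is the whole-space integral. [folklore] -/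
theorem setIntegral_inner_gradient_eq_integral {Q : Opens (ℝ × EuclideanSpace ℝ (Fin 3))}
    (v : ℝ → EuclideanSpace ℝ (Fin 3) → EuclideanSpace ℝ (Fin 3)) {θ : ℝ → EuclideanSpace ℝ (Fin 3) → ℝ}
    (hθ : IsSpaceTimeTestOn Q θ) :
    ∫ w in (Q : Set (ℝ × EuclideanSpace ℝ (Fin 3))), ⟪v w.1 w.2, gradient (θ w.1) w.2⟫ =
      ∫ w : ℝ × EuclideanSpace ℝ (Fin 3), ⟪v w.1 w.2, gradient (θ w.1) w.2⟫ :=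
  setIntegral_eq_integral_of_forall_compl_eq_zero fun w hw => by
    obtain ⟨s, y⟩ := w
    rw [gradient_slice_eq_zero_of_notMem hθ hw, inner_zero_right]

/-- **Covariance of the `ν = 0` local-energy functional under the Euler scaling**
`(u, p, φ) ↦ (α u ∘ Φ, α² p ∘ Φ, φ)`, `Φ(s,y) = (t₀ + βs, x₀ + γy)`, `β = αγ`:
`∫∫ (|u_α|² ∂ₛφ + (|u_α|² + 2p_α) u_α·∇φ) = α³γ (βγ³)⁻¹ ∫∫ (|u|² ∂ₜφ' + (|u|² + 2p) u·∇φ')`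
with `φ' = φ ∘ Φ⁻¹` (chain rule + change of variables; no integrability needed).
[cite: CaffarelliKohnNirenberg1982, §2] -/
theorem integral_localEnergyRHS_stRescale
    (u : ℝ → EuclideanSpace ℝ (Fin 3) → EuclideanSpace ℝ (Fin 3))
    (p : ℝ → EuclideanSpace ℝ (Fin 3) → ℝ) {α β γ : ℝ} (hα : 0 < α) (hγ : 0 < γ)
    (hβ : β = α * γ) (t₀ : ℝ) (x₀ : EuclideanSpace ℝ (Fin 3))
    (φ : ℝ → EuclideanSpace ℝ (Fin 3) → ℝ) :
    ∫ s, ∫ y, (‖(α • stPull β γ t₀ x₀ u) s y‖ ^ 2 * timeDeriv φ s y +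
        (‖(α • stPull β γ t₀ x₀ u) s y‖ ^ 2 + 2 * (α ^ 2 • stPull β γ t₀ x₀ p) s y) *
          ⟪(α • stPull β γ t₀ x₀ u) s y, gradient (φ s) y⟫) =
      α ^ 3 * γ * (β * γ ^ 3)⁻¹ *
        ∫ t, ∫ x, (‖u t x‖ ^ 2 * timeDeriv (stPull β⁻¹ γ⁻¹ (-(β⁻¹ * t₀)) (-(γ⁻¹ • x₀)) φ) t x +
          (‖u t x‖ ^ 2 + 2 * p t x) *
            ⟪u t x, gradient (stPull β⁻¹ γ⁻¹ (-(β⁻¹ * t₀)) (-(γ⁻¹ • x₀)) φ t) x⟫) := by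
  have hβ0 : 0 < β := by rw [hβ]; positivity
  set φ' := stPull β⁻¹ γ⁻¹ (-(β⁻¹ * t₀)) (-(γ⁻¹ • x₀)) φ with hφ'
  have hrepr : φ = stPull β γ t₀ x₀ φ' := (stPull_stPull_symm hβ0.ne' hγ.ne' t₀ x₀ φ).symm
  set R : ℝ → EuclideanSpace ℝ (Fin 3) → ℝ := fun t x => ‖u t x‖ ^ 2 * timeDeriv φ' t x +
      (‖u t x‖ ^ 2 + 2 * p t x) * ⟪u t x, gradient (φ' t) x⟫ with hR
  have keyR : ∀ s y, ‖(α • stPull β γ t₀ x₀ u) s y‖ ^ 2 * timeDeriv φ s y +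
        (‖(α • stPull β γ t₀ x₀ u) s y‖ ^ 2 + 2 * (α ^ 2 • stPull β γ t₀ x₀ p) s y) *
          ⟪(α • stPull β γ t₀ x₀ u) s y, gradient (φ s) y⟫ =
      (α ^ 3 * γ) * R (t₀ + β * s) (x₀ + γ • y) := by
    intro s y
    conv_lhs => rw [hrepr]
    rw [timeDeriv_stPull, gradient_stPull, smul_stPull_apply, smul_stPull_apply, hR]
    simp only [smul_eq_mul, norm_smul, Real.norm_eq_abs, abs_of_pos hα, mul_pow,
      real_inner_smul_left, real_inner_smul_right]
    rw [hβ]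
    ring
  simp_rw [keyR, integral_const_mul]
  rw [integral_integral_comp_stAffine hβ0 hγ t₀ x₀ R, finrank_euclideanSpace_fin]
  simp only [smul_eq_mul, hR]
  ring

/-- **Covariance of the weak divergence constraint**: if `∫∫_Q u·∇θ' = 0` for all
`θ' ∈ C_c^∞(Q)` then `∫∫_{Φ⁻¹Q} (α u ∘ Φ)·∇θ = 0` for all `θ ∈ C_c^∞(Φ⁻¹Q)` (the div-free block
of `IsDistributionalNSSolutionOn.stRescale`, isolated). [cite: CaffarelliKohnNirenberg1982, §2] -/
theorem setIntegral_inner_gradient_stRescale_eq_zero {Q : Opens (ℝ × EuclideanSpace ℝ (Fin 3))}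
    {u : ℝ → EuclideanSpace ℝ (Fin 3) → EuclideanSpace ℝ (Fin 3)}
    (hdiv : ∀ θ : ℝ → EuclideanSpace ℝ (Fin 3) → ℝ, IsSpaceTimeTestOn Q θ →
      ∫ w in (Q : Set (ℝ × EuclideanSpace ℝ (Fin 3))), ⟪u w.1 w.2, gradient (θ w.1) w.2⟫ = 0)
    (α : ℝ) {β γ : ℝ} (hβ : 0 < β) (hγ : 0 < γ) (t₀ : ℝ) (x₀ : EuclideanSpace ℝ (Fin 3))
    {θ : ℝ → EuclideanSpace ℝ (Fin 3) → ℝ} (hθ : IsSpaceTimeTestOn (stPreimage β γ t₀ x₀ Q) θ) :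
    ∫ w in ((stPreimage β γ t₀ x₀ Q : Opens (ℝ × EuclideanSpace ℝ (Fin 3))) :
        Set (ℝ × EuclideanSpace ℝ (Fin 3))),
      ⟪(α • stPull β γ t₀ x₀ u) w.1 w.2, gradient (θ w.1) w.2⟫ = 0 := by
  set θ' := stPull β⁻¹ γ⁻¹ (-(β⁻¹ * t₀)) (-(γ⁻¹ • x₀)) θ with hθ'
  have hθ'Q : IsSpaceTimeTestOn Q θ' := hθ.stPull_symm hβ.ne' hγ.ne'
  have hrepr : θ = stPull β γ t₀ x₀ θ' := (stPull_stPull_symm hβ.ne' hγ.ne' t₀ x₀ θ).symm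
  set F : ℝ × EuclideanSpace ℝ (Fin 3) → ℝ := fun w' => ⟪u w'.1 w'.2, gradient (θ' w'.1) w'.2⟫
    with hF
  have hzero : ∫ w in (Q : Set (ℝ × EuclideanSpace ℝ (Fin 3))), F w = 0 := hdiv θ' hθ'Q
  have key : ∀ w : ℝ × EuclideanSpace ℝ (Fin 3),
      ⟪(α • stPull β γ t₀ x₀ u) w.1 w.2, gradient (θ w.1) w.2⟫ =
        (α * γ) * F (stAffine β γ t₀ x₀ w) := by
    intro w
    conv_lhs => rw [hrepr]
    rw [gradient_stPull, smul_stPull_apply, real_inner_smul_left, real_inner_smul_right, hF]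
    simp only [stAffine_fst, stAffine_snd]
    ring
  rw [coe_stPreimage]
  simp_rw [key]
  rw [integral_const_mul, setIntegral_preimage_comp_stAffine hβ hγ, hzero, smul_zero, mul_zero]

end Transport

namespace IsSuperBlock

variable {T ν₀ τ σ a : ℝ} {z : EuclideanSpace ℝ (Fin 3)} {G : Set (EuclideanSpace ℝ (Fin 3))}
  {u : ℝ → EuclideanSpace ℝ (Fin 3) → EuclideanSpace ℝ (Fin 3)} {ρ : ℝ}
  {U : ℝ → EuclideanSpace ℝ (Fin 3) → EuclideanSpace ℝ (Fin 3)}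

/-! ### The Euler local energy inequality of `𝔘` -/

/-- **The local energy inequality of Euler for `(𝔘, p̃[𝔘])`**, in the verbatim shape of the
`localEnergy` field of `IsSuitableWeakSolutionOn Q 0 0 𝔘 p̃[𝔘]` (`ν = 0`, `f = 0`), on any open
`Q`: the support of a test function lies in one window, where `𝔘 = a^{-n}𝔲 ∘ Φ_n`,
`p̃[𝔘] = a^{-2n}p̃[𝔲] ∘ Φ_n`; the functional is `α³γ(βγ³)⁻¹ ≥ 0` times that of `(𝔲, p̃[𝔲])`
at `φ ∘ Φ_n⁻¹` (`integral_localEnergyRHS_stRescale`), which is `≥ 0` by the `ν = 0` local energy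
inequality of the weak NSI solution `𝔲` (`isWeakNSISolution_glueG`). [cite: Ozanski2017NSISingular, §2] -/
theorem ancient_localEnergyIneq (h : IsSuperBlock T ν₀ τ σ a z G u)
    (hU : ∀ (n : ℕ) (s : ℝ), -blowupTime T σ ≤ σ ^ (2 * n) * s →
      U s = ((a⁻¹) ^ n • stPull (σ ^ (2 * n)) (τ ^ n) (blowupTime T σ) (blowupPoint τ z)
        (glueG T σ τ a z u)) s) {Q : Opens (ℝ × EuclideanSpace ℝ (Fin 3))}
    (φ : ℝ → EuclideanSpace ℝ (Fin 3) → ℝ) (hφ : IsSpaceTimeTestOn Q φ) (hφ0 : ∀ t x, 0 ≤ φ t x) :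
    2 * (0 : ℝ) * ∫ t, ∫ x, frobeniusNormSq ((fun s y => fderiv ℝ (U s) y) t x) * φ t x ≤
      ∫ t, ∫ x, (‖U t x‖ ^ 2 * (timeDeriv φ t x + (0 : ℝ) * Δ (φ t) x) +
        (‖U t x‖ ^ 2 + 2 * (fun s => normalisedPressure (U s)) t x) * ⟪U t x, gradient (φ t) x⟫ +
        2 * ⟪(0 : ℝ → EuclideanSpace ℝ (Fin 3) → EuclideanSpace ℝ (Fin 3)) t x, U t x⟫ * φ t x) := by
  obtain ⟨n, hn⟩ := h.exists_window_of_isCompact hφ.hasCompactSupport.isCompact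
  have hβn : 0 < σ ^ (2 * n) := pow_pos h.σ_pos _
  have hτn : 0 < τ ^ n := pow_pos h.τ_pos n
  have hαn : 0 < (a⁻¹) ^ n := pow_pos (inv_pos.2 h.gain_pos) n
  set W : Opens (ℝ × EuclideanSpace ℝ (Fin 3)) := stPreimage (σ ^ (2 * n)) (τ ^ n) (blowupTime T σ)
    (blowupPoint τ z) positiveTimes with hW
  have hφW : IsSpaceTimeTestOn W φ := ⟨hφ.contDiff, hφ.hasCompactSupport, hn⟩
  -- the `ν = 0` local energy inequality of `𝔲`, tested with `φ ∘ Φ_n⁻¹`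
  obtain ⟨G', -, -, hLEI⟩ := (h.isWeakNSISolution_glueG ⟨le_rfl, h.block.ν₀_pos.le⟩).localEnergy
  have hφ'P : IsSpaceTimeTestOn positiveTimes (stPull (σ ^ (2 * n))⁻¹ (τ ^ n)⁻¹
      (-((σ ^ (2 * n))⁻¹ * blowupTime T σ)) (-((τ ^ n)⁻¹ • blowupPoint τ z)) φ) :=
    hφW.stPull_symm hβn.ne' hτn.ne'
  have key := hLEI _ hφ'P fun t x => hφ0 _ _
  simp only [mul_zero, zero_mul, add_zero] at key
  -- transport to the level-`n` field
  have htr := integral_localEnergyRHS_stRescale (glueG T σ τ a z u)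
    (fun s => normalisedPressure (glueG T σ τ a z u s)) hαn hτn (h.σ_pow_two_mul_eq_inv_gain_mul n)
    (blowupTime T σ) (blowupPoint τ z) φ
  have hpos : 0 ≤ ∫ s, ∫ y, (‖((a⁻¹) ^ n • stPull (σ ^ (2 * n)) (τ ^ n) (blowupTime T σ)
        (blowupPoint τ z) (glueG T σ τ a z u)) s y‖ ^ 2 * timeDeriv φ s y +
      (‖((a⁻¹) ^ n • stPull (σ ^ (2 * n)) (τ ^ n) (blowupTime T σ) (blowupPoint τ z)
          (glueG T σ τ a z u)) s y‖ ^ 2 +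
        2 * (((a⁻¹) ^ n) ^ 2 • stPull (σ ^ (2 * n)) (τ ^ n) (blowupTime T σ) (blowupPoint τ z)
          (fun s => normalisedPressure (glueG T σ τ a z u s))) s y) *
        ⟪((a⁻¹) ^ n • stPull (σ ^ (2 * n)) (τ ^ n) (blowupTime T σ) (blowupPoint τ z)
          (glueG T σ τ a z u)) s y, gradient (φ s) y⟫) := by
    rw [htr]
    exact mul_nonneg (mul_nonneg (mul_nonneg (pow_nonneg hαn.le 3) hτn.le)
      (inv_nonneg.2 (mul_nonneg hβn.le (pow_nonneg hτn.le 3)))) key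
  -- the integrands of the goal are those of the level-`n` field (both vanish off the window)
  have e : (fun t => ∫ x, (‖U t x‖ ^ 2 * (timeDeriv φ t x + (0 : ℝ) * Δ (φ t) x) +
      (‖U t x‖ ^ 2 + 2 * (fun s => normalisedPressure (U s)) t x) * ⟪U t x, gradient (φ t) x⟫ +
      2 * ⟪(0 : ℝ → EuclideanSpace ℝ (Fin 3) → EuclideanSpace ℝ (Fin 3)) t x, U t x⟫ * φ t x)) =
      fun s => ∫ y, (‖((a⁻¹) ^ n • stPull (σ ^ (2 * n)) (τ ^ n) (blowupTime T σ)
        (blowupPoint τ z) (glueG T σ τ a z u)) s y‖ ^ 2 * timeDeriv φ s y +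
      (‖((a⁻¹) ^ n • stPull (σ ^ (2 * n)) (τ ^ n) (blowupTime T σ) (blowupPoint τ z)
          (glueG T σ τ a z u)) s y‖ ^ 2 +
        2 * (((a⁻¹) ^ n) ^ 2 • stPull (σ ^ (2 * n)) (τ ^ n) (blowupTime T σ) (blowupPoint τ z)
          (fun s => normalisedPressure (glueG T σ τ a z u s))) s y) *
        ⟪((a⁻¹) ^ n • stPull (σ ^ (2 * n)) (τ ^ n) (blowupTime T σ) (blowupPoint τ z)
          (glueG T σ τ a z u)) s y, gradient (φ s) y⟫) := by
    funext t
    congr 1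
    funext x
    simp only [Pi.zero_apply, inner_zero_left, mul_zero, zero_mul, add_zero]
    by_cases hw : (t, x) ∈ (W : Set (ℝ × EuclideanSpace ℝ (Fin 3)))
    · rw [h.ancient_apply_of_mem_window hU hw, h.ancient_pressure_of_mem_window hU hw]
    · simp only [hφW.timeDeriv_eq_zero hw, gradient_slice_eq_zero_of_notMem hφW hw,
        inner_zero_right, mul_zero, add_zero]
  rw [e]
  simpa only [mul_zero, zero_mul] using hpos

/-! ### The divergence constraint of `𝔘` -/

/-- **`div 𝔘 = 0` weakly on any open `Q`**: the support of a test function lies in one window;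
there the identity is the Euler rescaling of `div 𝔲 = 0` (`IsWeakNSISolution.divFree` of
`isWeakNSISolution_glueG`, `setIntegral_inner_gradient_stRescale_eq_zero`), both set integrals
being whole-space integrals of integrands supported in `tsupport φ`. [cite: Ozanski2017NSISingular, §2] -/
theorem ancient_divFree (h : IsSuperBlock T ν₀ τ σ a z G u)
    (hU : ∀ (n : ℕ) (s : ℝ), -blowupTime T σ ≤ σ ^ (2 * n) * s →
      U s = ((a⁻¹) ^ n • stPull (σ ^ (2 * n)) (τ ^ n) (blowupTime T σ) (blowupPoint τ z)
        (glueG T σ τ a z u)) s) (Q : Opens (ℝ × EuclideanSpace ℝ (Fin 3))) :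
    ∀ θ : ℝ → EuclideanSpace ℝ (Fin 3) → ℝ, IsSpaceTimeTestOn Q θ →
      ∫ w in (Q : Set (ℝ × EuclideanSpace ℝ (Fin 3))), ⟪U w.1 w.2, gradient (θ w.1) w.2⟫ = 0 := by
  intro θ hθ
  obtain ⟨n, hn⟩ := h.exists_window_of_isCompact hθ.hasCompactSupport.isCompact
  have hβn : 0 < σ ^ (2 * n) := pow_pos h.σ_pos _
  have hτn : 0 < τ ^ n := pow_pos h.τ_pos n
  have hθW : IsSpaceTimeTestOn (stPreimage (σ ^ (2 * n)) (τ ^ n) (blowupTime T σ)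
      (blowupPoint τ z) positiveTimes) θ := ⟨hθ.contDiff, hθ.hasCompactSupport, hn⟩
  have hzero := setIntegral_inner_gradient_stRescale_eq_zero
    (h.isWeakNSISolution_glueG ⟨le_rfl, h.block.ν₀_pos.le⟩).divFree ((a⁻¹) ^ n) hβn hτn
    (blowupTime T σ) (blowupPoint τ z) hθW
  -- both set integrals are whole-space integrals, and the integrands agree everywhere
  rw [setIntegral_inner_gradient_eq_integral _ hθW] at hzero
  rw [setIntegral_inner_gradient_eq_integral _ hθ, ← hzero]
  congr 1
  funext w
  obtain ⟨s, y⟩ := w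
  by_cases hw : (s, y) ∈ ((stPreimage (σ ^ (2 * n)) (τ ^ n) (blowupTime T σ) (blowupPoint τ z)
      positiveTimes : Opens (ℝ × EuclideanSpace ℝ (Fin 3))) : Set (ℝ × EuclideanSpace ℝ (Fin 3)))
  · simp only [h.ancient_apply_of_mem_window hU hw]
  · simp only [gradient_slice_eq_zero_of_notMem hθW hw, inner_zero_right]

/-! ### `𝔘` is not trivial -/

/-- **`𝔘` is not a.e. zero on `(-∞,0) × ℝ³`**: on the window of level `0`, `𝔘(s) = 𝔲(T₀ + s)
(x₀ + ·)`, so `𝔘 = 0` a.e. on `(-T₀,0) × ℝ³` would make `𝔲 = 0` a.e. on `(0,T₀) × ℝ³`,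
contradicting the `L³` floor of the cascade on the Euler cylinders at its blow-up point
(`exists_eulerCylinder_L3_floor`). [cite: Ozanski2017NSISingular, §2] -/
theorem ancient_not_ae_eq_zero (h : IsSuperBlock T ν₀ τ σ a z G u) (hρ : a = τ ^ (-(1 + ρ)))
    (hU : ∀ (n : ℕ) (s : ℝ), -blowupTime T σ ≤ σ ^ (2 * n) * s →
      U s = ((a⁻¹) ^ n • stPull (σ ^ (2 * n)) (τ ^ n) (blowupTime T σ) (blowupPoint τ z)
        (glueG T σ τ a z u)) s) :
    ¬ (uncurry U =ᵐ[volume.restrict (Iio (0 : ℝ) ×ˢ (univ : Set (EuclideanSpace ℝ (Fin 3))))] 0) := by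
  intro hae
  have hT₀ := h.blowupTime_pos'
  have hρ0 := h.powerExp_pos hρ
  -- level `0`: `Φ₀(s,y) = (T₀ + s, x₀ + y)`, `Φ₀⁻¹((0,T₀) × ℝ³) = (-T₀, 0) × ℝ³`
  have hpre : stAffine 1 1 (blowupTime T σ) (blowupPoint τ z) ⁻¹'
      (Ioo 0 (blowupTime T σ) ×ˢ (univ : Set (EuclideanSpace ℝ (Fin 3)))) ⊆
      Iio (0 : ℝ) ×ˢ (univ : Set (EuclideanSpace ℝ (Fin 3))) := by
    rintro ⟨s, y⟩ hw
    simp only [mem_preimage, stAffine_apply, mem_prod, mem_Ioo, mem_univ, and_true, one_mul] at hw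
    exact ⟨show s < 0 by linarith, mem_univ _⟩
  have h1 : ∀ᵐ w ∂(volume.restrict (stAffine 1 1 (blowupTime T σ) (blowupPoint τ z) ⁻¹'
      (Ioo 0 (blowupTime T σ) ×ˢ (univ : Set (EuclideanSpace ℝ (Fin 3)))))),
      uncurry (glueG T σ τ a z u) (stAffine 1 1 (blowupTime T σ) (blowupPoint τ z) w) = 0 := by
    have h2 : ∀ᵐ w ∂(volume.restrict (stAffine 1 1 (blowupTime T σ) (blowupPoint τ z) ⁻¹'
        (Ioo 0 (blowupTime T σ) ×ˢ (univ : Set (EuclideanSpace ℝ (Fin 3)))))), uncurry U w = 0 :=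
      ae_restrict_of_ae_restrict_of_subset hpre hae
    filter_upwards [h2, ae_restrict_mem ((measurable_stAffine _ _ _ _)
      (measurableSet_Ioo.prod MeasurableSet.univ))] with w hw hmem
    obtain ⟨s, y⟩ := w
    simp only [mem_preimage, stAffine_apply, mem_prod, mem_Ioo, mem_univ, and_true, one_mul] at hmem
    have hwin : -blowupTime T σ ≤ σ ^ (2 * 0) * s := by
      simp only [mul_zero, pow_zero, one_mul]; linarith
    rw [uncurry_apply_pair, hU 0 s hwin] at hw
    simp only [smul_stPull_apply, mul_zero, pow_zero, one_smul, one_mul] at hw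
    simpa only [uncurry_apply_pair, stAffine_apply, one_mul, one_smul] using hw
  have h3 : ∀ᵐ w ∂(volume.restrict (Ioo 0 (blowupTime T σ) ×ˢ (univ : Set (EuclideanSpace ℝ (Fin 3))))),
      uncurry (glueG T σ τ a z u) w = 0 :=
    ae_restrict_of_ae_restrict_preimage_stAffine (P := fun w => uncurry (glueG T σ τ a z u) w = 0)
      one_pos one_pos _ _ h1
  -- the floor
  obtain ⟨ε₀, hε₀, hfloor⟩ := h.exists_eulerCylinder_L3_floor hρ
  obtain ⟨r, ⟨hr0, hrδ⟩, hr⟩ := hfloor (min 1 (blowupTime T σ)) (lt_min one_pos hT₀)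
  have hr1 : r < 1 := hrδ.trans_le (min_le_left _ _)
  have hrT : r < blowupTime T σ := hrδ.trans_le (min_le_right _ _)
  have hrpow : r ^ (2 + ρ) ≤ r := by
    calc r ^ (2 + ρ) ≤ r ^ (1 : ℝ) :=
          Real.rpow_le_rpow_of_exponent_ge hr0 hr1.le (by linarith)
      _ = r := Real.rpow_one r
  have hsub : Ioo (blowupTime T σ - r ^ (2 + ρ)) (blowupTime T σ) ×ˢ ball (blowupPoint τ z) r ⊆
      Ioo 0 (blowupTime T σ) ×ˢ (univ : Set (EuclideanSpace ℝ (Fin 3))) :=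
    Set.prod_mono (Ioo_subset_Ioo (by linarith) le_rfl) (subset_univ _)
  have h4 : (fun w : ℝ × EuclideanSpace ℝ (Fin 3) => ‖glueG T σ τ a z u w.1 w.2‖ₑ ^ (3 : ℕ))
      =ᵐ[volume.restrict (Ioo (blowupTime T σ - r ^ (2 + ρ)) (blowupTime T σ) ×ˢ
        ball (blowupPoint τ z) r)] fun _ => 0 := by
    filter_upwards [ae_restrict_of_ae_restrict_of_subset hsub h3] with w hw
    rw [uncurry_def] at hw
    simp only at hw
    simp [hw]
  rw [lintegral_congr_ae h4, lintegral_zero, mul_zero] at hr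
  exact absurd (ENNReal.ofReal_pos.2 hε₀) (not_lt.2 hr)

end IsSuperBlock

/-! ### The theorem -/

/-- **`PowerGaugeEulerLiouville` is false without the momentum identity** (see the file
docstring): for every `ρ ∈ (0, ρ₀]` the ancient zoom-out `𝔘` of a super-similar NSI cascade of
power exponent `ρ` (`exists_isSuperBlock_rateExp_eq` at `β = (1+ρ)/(2+ρ)`), with `p = p̃[𝔘]`
and `H = D𝔘`, satisfies every hypothesis of the crux E except the fifth conjunct of
`IsDistributionalNSSolutionOn` — listed verbatim, with the pressure law in its place — and is not
a.e. zero. [cite: Ozanski2017NSISingular, §2, §5] -/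
theorem powerGaugeEulerLiouville_false_without_momentum :
    ∃ ρ₀ : ℝ, 0 < ρ₀ ∧ ∀ ρ ∈ Ioc (0 : ℝ) ρ₀,
      ∃ (u : ℝ → EuclideanSpace ℝ (Fin 3) → EuclideanSpace ℝ (Fin 3))
        (p : ℝ → EuclideanSpace ℝ (Fin 3) → ℝ)
        (H : ℝ → EuclideanSpace ℝ (Fin 3) → EuclideanSpace ℝ (Fin 3) →L[ℝ] EuclideanSpace ℝ (Fin 3))
        (c : ℝ≥0),
        -- `IsDistributionalNSSolutionOn Q 0 0 u p`, conjuncts 1–4 (all but the momentum identity):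
        LocallyIntegrableOn (uncurry u)
          ((slab (EuclideanSpace ℝ (Fin 3)) (Iio 0) isOpen_Iio : Opens (ℝ × EuclideanSpace ℝ (Fin 3))) :
            Set (ℝ × EuclideanSpace ℝ (Fin 3))) volume ∧
        LocallyIntegrableOn (fun w => ‖uncurry u w‖ ^ 2)
          ((slab (EuclideanSpace ℝ (Fin 3)) (Iio 0) isOpen_Iio : Opens (ℝ × EuclideanSpace ℝ (Fin 3))) :
            Set (ℝ × EuclideanSpace ℝ (Fin 3))) volume ∧
        LocallyIntegrableOn (uncurry p)
          ((slab (EuclideanSpace ℝ (Fin 3)) (Iio 0) isOpen_Iio : Opens (ℝ × EuclideanSpace ℝ (Fin 3))) :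
            Set (ℝ × EuclideanSpace ℝ (Fin 3))) volume ∧
        (∀ θ : ℝ → EuclideanSpace ℝ (Fin 3) → ℝ,
          IsSpaceTimeTestOn (slab (EuclideanSpace ℝ (Fin 3)) (Iio 0) isOpen_Iio) θ →
          ∫ w in ((slab (EuclideanSpace ℝ (Fin 3)) (Iio 0) isOpen_Iio :
              Opens (ℝ × EuclideanSpace ℝ (Fin 3))) : Set (ℝ × EuclideanSpace ℝ (Fin 3))),
            ⟪u w.1 w.2, gradient (θ w.1) w.2⟫ = 0) ∧
        -- in place of conjunct 5: the pressure LAW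
        (p = fun s => normalisedPressure (u s)) ∧
        -- `IsSuitableWeakSolutionOn Q 0 0 u p`: `energyClass`, `pressure`, `localEnergy`, verbatim:
        (∀ K ⊆ ((slab (EuclideanSpace ℝ (Fin 3)) (Iio 0) isOpen_Iio :
            Opens (ℝ × EuclideanSpace ℝ (Fin 3))) : Set (ℝ × EuclideanSpace ℝ (Fin 3))),
          IsCompact K → ∃ C : ℝ≥0, ∀ᵐ t : ℝ,
            ∫⁻ x, K.indicator (fun w : ℝ × EuclideanSpace ℝ (Fin 3) => ‖u w.1 w.2‖ₑ ^ 2) (t, x) ≤ C) ∧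
        (∀ K ⊆ ((slab (EuclideanSpace ℝ (Fin 3)) (Iio 0) isOpen_Iio :
            Opens (ℝ × EuclideanSpace ℝ (Fin 3))) : Set (ℝ × EuclideanSpace ℝ (Fin 3))),
          IsCompact K → ∫⁻ w in K, ‖p w.1 w.2‖ₑ ^ (3 / 2 : ℝ) < ∞) ∧
        (∃ G : ℝ → EuclideanSpace ℝ (Fin 3) → EuclideanSpace ℝ (Fin 3) →L[ℝ] EuclideanSpace ℝ (Fin 3),
          HasWeakSpatialGradientOn (slab (EuclideanSpace ℝ (Fin 3)) (Iio 0) isOpen_Iio) u G ∧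
          (∀ K ⊆ ((slab (EuclideanSpace ℝ (Fin 3)) (Iio 0) isOpen_Iio :
              Opens (ℝ × EuclideanSpace ℝ (Fin 3))) : Set (ℝ × EuclideanSpace ℝ (Fin 3))),
            IsCompact K → ∫⁻ w in K, ENNReal.ofReal (frobeniusNormSq (G w.1 w.2)) < ∞) ∧
          ∀ φ : ℝ → EuclideanSpace ℝ (Fin 3) → ℝ,
            IsSpaceTimeTestOn (slab (EuclideanSpace ℝ (Fin 3)) (Iio 0) isOpen_Iio) φ →
            (∀ t x, 0 ≤ φ t x) →
            2 * (0 : ℝ) * ∫ t, ∫ x, frobeniusNormSq (G t x) * φ t x ≤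
              ∫ t, ∫ x, (‖u t x‖ ^ 2 * (timeDeriv φ t x + (0 : ℝ) * Δ (φ t) x) +
                (‖u t x‖ ^ 2 + 2 * p t x) * ⟪u t x, gradient (φ t) x⟫ +
                2 * ⟪(0 : ℝ → EuclideanSpace ℝ (Fin 3) → EuclideanSpace ℝ (Fin 3)) t x, u t x⟫ *
                  φ t x)) ∧
        -- the remaining hypotheses of the crux, verbatim:
        HasWeakSpatialGradientOn (slab (EuclideanSpace ℝ (Fin 3)) (Iio 0) isOpen_Iio) u H ∧
        (∀ a : ℝ, 0 < a →
          ENNReal.ofReal (a ^ (2 * ρ)) * cknA a (0 : ℝ × EuclideanSpace ℝ (Fin 3)) u +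
            ENNReal.ofReal (a ^ ρ) * cknE a (0 : ℝ × EuclideanSpace ℝ (Fin 3)) H +
            ENNReal.ofReal (a ^ (2 * ρ)) * cknD a (0 : ℝ × EuclideanSpace ℝ (Fin 3)) p ≤ (c : ℝ≥0∞)) ∧
        -- and the NEGATION of its conclusion:
        ¬ (uncurry u =ᵐ[volume.restrict (Iio (0 : ℝ) ×ˢ (univ : Set (EuclideanSpace ℝ (Fin 3))))] 0) := by
  obtain ⟨β₀, hβ₀, hβ₀', hreach⟩ := exists_isSuperBlock_rateExp_eq
  have h1β₀ : 0 < 1 - β₀ := by linarith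
  refine ⟨(2 * β₀ - 1) / (1 - β₀), div_pos (by linarith) h1β₀, fun ρ hρI => ?_⟩
  obtain ⟨hρ0, hρ1⟩ := hρI
  -- a super block of power exponent `ρ`
  have h2ρ : 0 < 2 + ρ := by linarith
  have hβI : (1 + ρ) / (2 + ρ) ∈ Ioc (1 / 2 : ℝ) β₀ := by
    refine ⟨by rw [lt_div_iff₀ h2ρ]; linarith, ?_⟩
    rw [div_le_iff₀ h2ρ]
    rw [le_div_iff₀ h1β₀] at hρ1
    nlinarith
  obtain ⟨T, ν₀, τ, σ, a, z, G, u, hS, hlog⟩ := hreach _ hβI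
  have hρ' := hS.gain_eq_rpow
  have hrate := hS.rateExp_eq_of_powerExp hρ'
  rw [hlog] at hrate
  have h2ρ' : 0 < 2 + (Real.logb τ⁻¹ a - 1) := by linarith [hS.powerExp_pos hρ']
  have hρρ : Real.logb τ⁻¹ a - 1 = ρ := by
    rw [div_eq_div_iff h2ρ.ne' h2ρ'.ne'] at hrate
    nlinarith
  rw [hρρ] at hρ'
  -- the ancient cascade
  obtain ⟨U, hU⟩ := hS.exists_ancientGlue
  set Q : Opens (ℝ × EuclideanSpace ℝ (Fin 3)) := slab (EuclideanSpace ℝ (Fin 3)) (Iio 0) isOpen_Iio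
    with hQ
  obtain ⟨hli, hli2, hlip, -⟩ := hS.ancient_locallyIntegrableOn hρ' hU Q
  obtain ⟨c, hc⟩ := hS.ancient_powerGauges_le_nnreal hρ' hU
  exact ⟨U, fun s => normalisedPressure (U s), fun s y => fderiv ℝ (U s) y, c, hli, hli2, hlip,
    hS.ancient_divFree hU Q, rfl, hS.ancient_energyClass hρ' hU _, hS.ancient_pressureClass hρ' hU _,
    ⟨fun s y => fderiv ℝ (U s) y, hS.ancient_hasWeakSpatialGradientOn hρ' hU Q,
      hS.ancient_gradientClass hρ' hU _, fun φ hφ hφ0 => hS.ancient_localEnergyIneq hU φ hφ hφ0⟩,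
    hS.ancient_hasWeakSpatialGradientOn hρ' hU Q, hc, hS.ancient_not_ae_eq_zero hρ' hU⟩

end Summit.NavierStokesRegularity.NavierStokesRegularity.Theorems.TypeIliouvilleNoTypeIINegative

end
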